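import Literature.Analysis.FluidPDE.CriticalRegularity
import Literature.Analysis.FluidPDE.CriticalRegularityProofs
import Literature.Analysis.FluidPDE.CriticalSpacesProofs
import Literature.Analysis.FluidPDE.LerayHopfSpatialGradient
import Literature.Analysis.FluidPDE.SobolevWeakGradient
import Literature.Analysis.FunctionSpaces.LittlewoodPaleyBernsteinProofs
import Literature.Analysis.FunctionSpaces.LittlewoodPaleyPartitionProofs
import Literature.Analysis.FunctionSpaces.LittlewoodPaleyProofs
import Mathlib.Topology.Algebra.Order.LiminfLimsup
import HarnessLib

/-!
# Cheskidov–Shvydkoy's `B^{-1}_{∞,∞}` regularity criterion: the printed (inhomogeneous) form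

Sibling file of `Literature/Analysis/FluidPDE/CriticalRegularity.lean`, serving the named fact
`Literature.Analysis.FluidPDE.cheskidov_shvydkoy` (**ns.S31**; Cheskidov–Shvydkoy, Arch. Ration. Mech. Anal. 195
(2010), Thm. 3.1). That fact is a *theory*, not a lemma (see "Status" below); this file records
the printed statements it rests on as named facts and **proves** the reduction of the accepted
homogeneous rendering `NS.cheskidov_shvydkoy` (jumps measured in `Ḃ^{-1}_{∞,∞}`,
`Literature.eHomBesovNorm (-1) ∞ ∞`) to the theorem *as printed* (jumps measured in the inhomogeneous
space `B^{-1}_{∞,∞}`, `Literature.eBesovNorm (-1) ∞ ∞`), i.e. the claim made in the design notes of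
`CriticalRegularity.lean` ("the inhomogeneous norm is bounded by twice the homogeneous norm for
`L²` data").

## What is proved

* **Low-frequency Bernstein inequality** (BCD Lemma 2.1 with `λ = 1` for the ball instead of the
  annulus): `‖Ṡ₀ v‖_{L^r} ≤ C ‖v‖_{L^p}` and, by dyadic scaling,
  `‖Ṡ_k v‖_{L^r} ≤ C 2^{k d (1/p - 1/r)} ‖v‖_{L^p}` for `1 ≤ p ≤ r ≤ ∞`
  (`Literature.Analysis.FluidPDE.exists_eLpNormDistrib_lowFreqCutoff_zero_le`, `Literature.Analysis.FluidPDE.exists_eLpNormDistrib_lowFreqCutoff_le`).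
* **Telescoping** `Ṡ₀ = Ṡ_{-n} + ∑_{i<n} Δ̇_{-i}` (`Literature.Analysis.FluidPDE.lowFreqCutoff_zero_eq_add_sum`, from the
  accepted `Literature.Analysis.FunctionSpaces.lpBlock_eq_sub`), and the block bound
  `‖Δ̇_j u‖_{L^p} ≤ 2^{-js} ‖u‖_{Ḃ^s_{p,∞}}`.
* **Inhomogeneous versus homogeneous norm at regularity `-1`**: for a distribution `v ∈ L^q`,
  `q < p`, on a finite-dimensional space of positive dimension,
  `‖Ṡ₀ v‖_{L^p} ≤ 2 ‖v‖_{Ḃ^{-1}_{p,∞}}` and `‖v‖_{B^{-1}_{p,∞}} ≤ 3 ‖v‖_{Ḃ^{-1}_{p,∞}}`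
  (`Literature.Analysis.FluidPDE.eLpNormDistrib_lowFreqCutoff_zero_le_two_mul`, `Literature.Analysis.FluidPDE.eBesovNorm_le_three_mul_eHomBesovNorm`):
  `‖Ṡ₀ v‖_p ≤ ‖Ṡ_{-n} v‖_p + ∑_{i<n} 2^{-i} ‖v‖_{Ḃ^{-1}_{p,∞}} ≤ C 2^{-n d(1/q-1/p)} ‖v‖_q + 2‖v‖_{Ḃ^{-1}}`
  and `n → ∞`. (For `q = p` the statement is false: constants.)
* **The reduction** `Literature.NS.cheskidov_shvydkoy_of_inhom : cheskidov_shvydkoy_inhom → cheskidov_shvydkoy`: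
  the slices of a Leray–Hopf solution are `L²`, so their increments `U t - U t₀` are `L²`
  distributions (`NS.IsDistributionOf.coe_toLp`) and the printed hypothesis with constant `c`
  follows from the homogeneous one with constant `c / 3`.
* **Cor. 3.3 from Lemma 3.2** (`Literature.Analysis.FluidPDE.cheskidov_shvydkoy_small_of_dyadic`): the dyadic pieces
  `2^{-j} ‖Δ̇_j U(t)‖_∞`, `j ≥ 1`, are dominated by `‖U(t)‖_{B^{-1}_{∞,∞}}`.
* **The dyadic tail** `Literature.dyadicTail s p v = limsup_{j → ∞} 2^{js} ‖Δ̇_j v‖_{L^p}` (CS's `φ(t)`,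
  p. 6): subadditive, even, dominated by the inhomogeneous norm; it **vanishes for `L^q` data
  with `q > d`** (`Literature.Analysis.FluidPDE.dyadicTail_eq_zero_of_eLpNormDistrib_ne_top`, Bernstein), hence **at a.e.
  time of a Leray–Hopf solution on `ℝ³`** (`Literature.Analysis.FluidPDE.ae_dyadicTail_eq_zero_of_isLerayHopfOn`:
  measurable weak gradient + `H¹ ⊂ L⁶`); the **left-neighbourhood lemma**
  `Literature.Analysis.FluidPDE.exists_limsup_biSup_lpBlockWeight_lt` of CS's proof of Thm. 3.1 (p. 6), and its
  Leray–Hopf form `Literature.Analysis.FluidPDE.exists_limsup_biSup_lpBlockWeight_lt_of_isLerayHopfOn`: the jump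
  hypothesis of Thm. 3.1 at `β` yields the hypothesis of Lemma 3.2 on some `(t₁, β)`.

Named facts (not proved): `NS.cheskidov_shvydkoy_inhom` (Thm. 3.1 as printed),
`NS.cheskidov_shvydkoy_dyadic` (Lemma 3.2), `NS.cheskidov_shvydkoy_small` (Cor. 3.3, also
derived from Lemma 3.2).

## Conventions (Cheskidov–Shvydkoy §2.1 versus `LittlewoodPaley.lean`)

CS fix a nonnegative radial `χ ∈ C₀^∞(B₂)` with `χ = 1` on `|ξ| ≤ 1`, put `λ_q = 2^q`,
`u_{-1} = χ(D) u`, `u_q = φ(λ_q⁻¹ D) u` with `φ(ξ) = χ(ξ/2) - χ(ξ)` (`q ≥ 0`), and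
`‖u‖_{B^s_{p,∞}} = sup_{q ≥ -1} λ_q^s ‖u_q‖_p` (arXiv:0708.3067, p. 4). In the accepted
`LittlewoodPaley.lean`, `χ = Literature.dyadicCutoff` (Mathlib's bump function: smooth, values in
`[0, 1]`, `= 1` on the closed unit ball, support the open ball of radius `2`),
`Ṡ_j = χ(2^{-j} D)` and `Δ̇_j = Ṡ_j - Ṡ_{j-1}`; hence `u_{-1} = Ṡ₀ u` and `u_q = Δ̇_{q+1} u`,
so that
`sup_{q ≥ -1} λ_q^{-1} ‖u_q‖_∞ = 2 · max (‖Ṡ₀ u‖_∞, sup_{j ≥ 1} 2^{-j} ‖Δ̇_j u‖_∞) ≤ 2 · eBesovNorm (-1) ∞ ∞ u`.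
The printed theorem (absolute constant `c`) therefore yields `cheskidov_shvydkoy_inhom` with
constant `c / 2`; the constant being existentially quantified, the rendering is faithful. (CS ask
for a *radial* `χ ∈ C₀^∞(B₂)`; Mathlib's bump is only known to be even, and its topological
support is the closed ball. Both points are immaterial: the printed proof uses `χ` only through
Bernstein's inequalities and the algebra of the dyadic partition (`∫ 𝓕⁻¹φ_q = φ_q(0) = 0` in the
remainder formula for `(u ⊗ u)_q`), valid for any such cutoff — the same convention under which
the accepted `NS.cheskidov_shvydkoy` was stated.)

## Status of the named fact `cheskidov_shvydkoy` (not discharged here) and plan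

Printed architecture (arXiv:0708.3067, pp. 4–6): Thm. 3.1 follows from

1. **Lemma 3.2** (`NS.cheskidov_shvydkoy_dyadic` below): if
   `limsup_{q → ∞} sup_{t ∈ (0,T)} λ_q⁻¹ ‖u_q(t)‖_∞ < c ν` then `u` is regular on `(0, T]` —
   proved by testing the weak formulation with `λ_q^{1+ε} (u_q)_q` on an interval of regularity,
   the paraproduct-remainder decomposition `(u ⊗ u)_q = r_q(u,u) + u_q ⊗ u + u ⊗ u_q`
   (Cheskidov–Constantin–Friedlander–Shvydkoy 2008), Hölder and Bernstein, absorbing the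
   high-frequency part into the dissipation, which bounds `‖u(t)‖_{H^{1/2+ε}}` on the interval;
2. **Theorem 2.4** (Leray's continuation theorem): a Leray–Hopf solution whose `H^s` norm,
   `s > 1/2`, stays bounded at the right end of every interval of regularity is regular on
   `(0, T]` (Leray's structure theorem: local strong solutions + weak–strong uniqueness);
3. the proof of Thm. 3.1 (p. 6): on an interval of regularity `u(t) ∈ C^∞`, so the dyadic tail
   `limsup_q λ_q⁻¹‖u_q(t)‖_∞` vanishes there; the jump hypothesis transports this to the right
   endpoint, Lemma 3.2 (with half the constant) applies on `(t₀, β]`, and Thm. 2.4 concludes;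
4. "regular" in CS means `‖u(t)‖_{H¹}` continuous; the house rendering (as for ns.S07) is a
   classical representative on `Ioc 0 T`, which additionally uses parabolic smoothing of
   strong solutions (Ladyzhenskaya–Prodi–Serrin, `NS.ladyzhenskaya_prodi_serrin`).

None of 1–4 exists in Mathlib or in this tree (Littlewood–Paley product estimates, the
Leray structure theorem, local strong well-posedness; restarting a general Leray–Hopf solution
at an a.e. time is only available for classical ones,
`Fluid.IsLerayHopfOn.ae_isLerayHopfOn_translate`). They are the leaves of the plan; this file
supplies the proved top of the DAG:
`cheskidov_shvydkoy ⇐ cheskidov_shvydkoy_inhom ⇐ (cheskidov_shvydkoy_dyadic + Thm. 2.4 + 3–4)`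
(first arrow proved here, second open), `cheskidov_shvydkoy_small ⇐ cheskidov_shvydkoy_dyadic`
(proved here), and step 3 up to the appeal to Lemma 3.2 and Thm. 2.4
(`NS.exists_limsup_biSup_lpBlockWeight_lt_of_isLerayHopfOn`: for a Leray–Hopf solution, small
left jumps at `β` in `B^{-1}_{∞,∞}` give the hypothesis of Lemma 3.2 on a left neighbourhood
`(t₁, β)` with twice the constant — proved here). Open leaves for the second arrow: Lemma 3.2
itself, restarting a Leray–Hopf solution at a.e. time, and Leray's continuation theorem
(CS Thm. 2.4; Robinson–Rodrigo–Sadowski 2016, §8.3) to pass the junction points.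

## References

* A. Cheskidov, R. Shvydkoy, *The regularity of weak solutions of the 3D Navier–Stokes equations
  in `B^{-1}_{∞,∞}`*, Arch. Ration. Mech. Anal. 195 (2010) 159–169 (arXiv:0708.3067): §2.1
  (p. 4, Besov spaces), Def. 2.1/2.3 and Thm. 2.4 (p. 4), Thm. 3.1 and Lemma 3.2 (p. 5), proof of
  Thm. 3.1 and Cor. 3.3 (p. 6).
* H. Bahouri, J.-Y. Chemin, R. Danchin, *Fourier Analysis and Nonlinear PDE* (2011), Lemma 2.1
  (Bernstein), Def. 2.15, Def. 2.68 ("BCD").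
* J. C. Robinson, J. L. Rodrigo, W. Sadowski, *The Three-Dimensional Navier–Stokes Equations*
  (CUP 2016), Thm. 1.7 (i) (`H¹ ⊂ L⁶`), §8.3 (epochs of regularity).
-/

noncomputable section

open MeasureTheory FourierTransform RealInnerProductSpace TemperedDistribution Filter Topology
  Function Set
open scoped SchwartzMap ENNReal NNReal Convolution

namespace Literature.Analysis.FluidPDE

/-! ## Low-frequency Bernstein inequality -/

section LowFreqBernstein

variable {E : Type*} [NormedAddCommGroup E] [InnerProductSpace ℝ E] [FiniteDimensional ℝ E]
  [MeasurableSpace E] [BorelSpace E]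

variable (E) in
/-- The low-frequency symbol `χ = χ(2^{-0}·)` (`Literature.lowFreqSymbol 0`) as a Schwartz function
(smooth with compact support; BCD Prop. 2.10). [folklore] -/
def lowFreqSchwartz : 𝓢(E, ℂ) :=
  (FunctionSpaces.hasCompactSupport_lowFreqSymbol 0).toSchwartzMap (FunctionSpaces.contDiff_lowFreqSymbol 0)

omit [MeasurableSpace E] [BorelSpace E] in
/-- The Schwartz function `lowFreqSchwartz` is the symbol `χ` of `Ṡ₀`. [folklore] -/
@[simp]
theorem coe_lowFreqSchwartz : ((lowFreqSchwartz E : 𝓢(E, ℂ)) : E → ℂ) = FunctionSpaces.lowFreqSymbol 0 :=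
  rfl

variable (E) in
/-- The **low-frequency kernel** `h = 𝓕⁻ χ ∈ 𝓢(E, ℂ)`, so that `Ṡ₀ f = h ⋆ f` for `f ∈ L^p`
(BCD, proof of Lemma 2.1). [folklore] -/
def lowFreqKernel : 𝓢(E, ℂ) := 𝓕⁻ (lowFreqSchwartz E : 𝓢(E, ℂ))

variable {F : Type*} [NormedAddCommGroup F] [NormedSpace ℂ F] [CompleteSpace F]

/-- **Low-frequency Bernstein inequality at frequency `1`** (BCD Lemma 2.1, the case of a ball
`supp û ⊆ B(0, λ)`, `λ = 2`, `k = 0`): for `1 ≤ p ≤ r ≤ ∞` there is `C ≠ 0` with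
`‖Ṡ₀ v‖_{L^r} ≤ C ‖v‖_{L^p}` for every `v ∈ 𝓢'(E, F)`: if `v = f ∈ L^p` then
`Ṡ₀ v = χ(D) f = h ⋆ f ∈ L^r` with `‖h ⋆ f‖_r ≤ C ‖f‖_p` (Young's inequality,
`Literature.Analysis.FunctionSpaces.exists_eLpNorm_convolution_smul_le`); if `v ∉ L^p` the right-hand side is `∞`. Twin of the
accepted block version `Literature.Analysis.FunctionSpaces.exists_eLpNormDistrib_lpBlock_zero_le`. [cite: BahouriCheminDanchin2011, Lemma 2.1] -/
theorem exists_eLpNormDistrib_lowFreqCutoff_zero_le (p r : ℝ≥0∞) [hp : Fact (1 ≤ p)]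
    [Fact (1 ≤ r)] (hpr : p ≤ r) :
    ∃ C : ℝ≥0, C ≠ 0 ∧ ∀ v : 𝓢'(E, F),
      FunctionSpaces.eLpNormDistrib r (FunctionSpaces.lowFreqCutoff 0 v) ≤ C * FunctionSpaces.eLpNormDistrib p v := by
  haveI : p.HolderConjugate (1 - p⁻¹)⁻¹ := ENNReal.HolderConjugate.inv_one_sub_inv' hp.out
  have hK : AEStronglyMeasurable (⇑(lowFreqKernel E)) (volume : Measure E) :=
    (lowFreqKernel E).continuous.aestronglyMeasurable
  obtain ⟨C, hC⟩ := FunctionSpaces.exists_eLpNorm_convolution_smul_le (F := F) (μ := (volume : Measure E)) hK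
    ((lowFreqKernel E).eLpNorm_lt_top 1 volume)
    ((lowFreqKernel E).eLpNorm_lt_top ((1 - p⁻¹)⁻¹) volume) hpr
  refine ⟨max C 1, (lt_max_of_lt_right one_pos).ne', fun v => ?_⟩
  by_cases h : ∃ f : Lp F p (volume : Measure E), (f : 𝓢'(E, F)) = v
  · obtain ⟨f, hf⟩ := h
    have hfm : AEStronglyMeasurable (f : E → F) volume := Lp.aestronglyMeasurable f
    have hg : MemLp ((⇑(lowFreqKernel E)) ⋆[ContinuousLinearMap.lsmul ℂ ℂ, volume] (f : E → F))
        r volume :=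
      ⟨FunctionSpaces.aestronglyMeasurable_convolution_smul hK hfm, (hC _ hfm).trans_lt
        (ENNReal.mul_lt_top ENNReal.coe_lt_top (Lp.memLp f).eLpNorm_lt_top)⟩
    -- `Ṡ₀ v = χ(D) f = h ⋆ f` as distributions
    have hrep : ((hg.toLp _ : Lp F r (volume : Measure E)) : 𝓢'(E, F)) = FunctionSpaces.lowFreqCutoff 0 v := by
      rw [FunctionSpaces.lowFreqCutoff_apply, ← hf, ← coe_lowFreqSchwartz]
      ext u
      rw [Lp.toTemperedDistribution_apply, FunctionSpaces.fourierMultiplierCLM_coe_apply_eq_integral_convolution]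
      refine integral_congr_ae ?_
      filter_upwards [hg.coeFn_toLp] with y hy
      rw [hy]
      rfl
    calc FunctionSpaces.eLpNormDistrib r (FunctionSpaces.lowFreqCutoff 0 v)
        ≤ ‖(hg.toLp _ : Lp F r (volume : Measure E))‖ₑ := by
          rw [← hrep]; exact FunctionSpaces.eLpNormDistrib_coe_le _
      _ = eLpNorm ((⇑(lowFreqKernel E)) ⋆[ContinuousLinearMap.lsmul ℂ ℂ, volume] (f : E → F))
            r volume := Lp.enorm_toLp hg
      _ ≤ C * eLpNorm (f : E → F) p volume := hC _ hfm
      _ ≤ ((max C 1 : ℝ≥0) : ℝ≥0∞) * eLpNorm (f : E → F) p volume := by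
          gcongr
          exact le_max_left _ _
      _ = ((max C 1 : ℝ≥0) : ℝ≥0∞) * FunctionSpaces.eLpNormDistrib p v := by
          rw [← hf, FunctionSpaces.eLpNormDistrib_coe, Lp.enorm_def]
  · push Not at h
    rw [FunctionSpaces.eLpNormDistrib_of_forall_ne h, ENNReal.mul_top (by simp)]
    exact le_top

/-- **Low-frequency Bernstein inequality** (BCD Lemma 2.1, ball case, general `λ = 2^{k+1}`,
derived from frequency `1` by the dyadic scaling `Ṡ_k u = (Ṡ₀ (u(2^{-k}·)))(2^k ·)`,
`Literature.Analysis.FunctionSpaces.lowFreqCutoff_distribDilate`, and `‖w(2^k ·)‖_{L^p} = 2^{-kd/p} ‖w‖_{L^p}`): for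
`1 ≤ p ≤ r ≤ ∞` there is `C ≠ 0` such that for every `k ∈ ℤ` and `u ∈ 𝓢'(E, F)`,
`‖Ṡ_k u‖_{L^r} ≤ C 2^{k d (1/p - 1/r)} ‖u‖_{L^p}`, `d = dim E` (`1/∞ = 0` through
`(∞ : ℝ≥0∞).toReal⁻¹ = 0`). [cite: BahouriCheminDanchin2011, Lemma 2.1] -/
theorem exists_eLpNormDistrib_lowFreqCutoff_le (p r : ℝ≥0∞) [Fact (1 ≤ p)] [Fact (1 ≤ r)]
    (hpr : p ≤ r) :
    ∃ C : ℝ≥0, C ≠ 0 ∧ ∀ (k : ℤ) (u : 𝓢'(E, F)),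
      FunctionSpaces.eLpNormDistrib r (FunctionSpaces.lowFreqCutoff k u) ≤
        C * (2 : ℝ≥0∞) ^ ((k : ℝ) * Module.finrank ℝ E * (p.toReal⁻¹ - r.toReal⁻¹)) *
          FunctionSpaces.eLpNormDistrib p u := by
  obtain ⟨C, hC0, hC⟩ := exists_eLpNormDistrib_lowFreqCutoff_zero_le (E := E) (F := F) p r hpr
  refine ⟨C, hC0, fun k u => ?_⟩
  set c : ℝˣ := Units.mk0 ((2 : ℝ) ^ k) (zpow_ne_zero k two_ne_zero) with hc
  set w : 𝓢'(E, F) := FunctionSpaces.distribDilate c⁻¹ u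
  have hu : u = FunctionSpaces.distribDilate c w := (FunctionSpaces.distribDilate_distribDilate_inv c u).symm
  have hcut : FunctionSpaces.lowFreqCutoff k u = FunctionSpaces.distribDilate c (FunctionSpaces.lowFreqCutoff 0 w) := by
    conv_lhs => rw [hu, hc, FunctionSpaces.lowFreqCutoff_distribDilate k k w, sub_self]
  have hr : FunctionSpaces.eLpNormDistrib r (FunctionSpaces.lowFreqCutoff k u) =
      (2 : ℝ≥0∞) ^ (-((k : ℝ) * Module.finrank ℝ E) / r.toReal) *
        FunctionSpaces.eLpNormDistrib r (FunctionSpaces.lowFreqCutoff 0 w) := by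
    rw [hcut, FunctionSpaces.eLpNormDistrib_distribDilate, hc, Units.val_mk0, FunctionSpaces.dilateConst_two_zpow]
  have hp : FunctionSpaces.eLpNormDistrib p u =
      (2 : ℝ≥0∞) ^ (-((k : ℝ) * Module.finrank ℝ E) / p.toReal) * FunctionSpaces.eLpNormDistrib p w := by
    conv_lhs => rw [hu]
    rw [FunctionSpaces.eLpNormDistrib_distribDilate, hc, Units.val_mk0, FunctionSpaces.dilateConst_two_zpow]
  rw [hr, hp]
  calc (2 : ℝ≥0∞) ^ (-((k : ℝ) * Module.finrank ℝ E) / r.toReal) *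
        FunctionSpaces.eLpNormDistrib r (FunctionSpaces.lowFreqCutoff 0 w)
      ≤ (2 : ℝ≥0∞) ^ (-((k : ℝ) * Module.finrank ℝ E) / r.toReal) *
          (C * FunctionSpaces.eLpNormDistrib p w) := by
        gcongr
        exact hC w
    _ = C * ((2 : ℝ≥0∞) ^ ((k : ℝ) * Module.finrank ℝ E * (p.toReal⁻¹ - r.toReal⁻¹)) *
          (2 : ℝ≥0∞) ^ (-((k : ℝ) * Module.finrank ℝ E) / p.toReal)) *
          FunctionSpaces.eLpNormDistrib p w := by
        rw [FunctionSpaces.two_rpow_mul_two_rpow,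
          show (k : ℝ) * Module.finrank ℝ E * (p.toReal⁻¹ - r.toReal⁻¹) +
              -((k : ℝ) * Module.finrank ℝ E) / p.toReal =
            -((k : ℝ) * Module.finrank ℝ E) / r.toReal by ring]
        ring
    _ = C * (2 : ℝ≥0∞) ^ ((k : ℝ) * Module.finrank ℝ E * (p.toReal⁻¹ - r.toReal⁻¹)) *
          ((2 : ℝ≥0∞) ^ (-((k : ℝ) * Module.finrank ℝ E) / p.toReal) *
            FunctionSpaces.eLpNormDistrib p w) := by ring

end LowFreqBernstein

/-! ## The inhomogeneous norm `B^{-1}_{p,∞}` against the homogeneous norm `Ḃ^{-1}_{p,∞}` -/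

section LowFreqComparison

variable {E F : Type*} [NormedAddCommGroup E] [InnerProductSpace ℝ E] [FiniteDimensional ℝ E]
  [MeasurableSpace E] [BorelSpace E] [NormedAddCommGroup F] [NormedSpace ℂ F]

/-- **Telescoping of the low frequencies**: `Ṡ₀ v = Ṡ_{-n} v + ∑_{i<n} Δ̇_{-i} v` for every
`n ∈ ℕ` (iterate `Δ̇_j = Ṡ_j - Ṡ_{j-1}`, the accepted `Literature.Analysis.FunctionSpaces.lpBlock_eq_sub`; BCD (2.5)). [folklore] -/
theorem lowFreqCutoff_zero_eq_add_sum (v : 𝓢'(E, F)) (n : ℕ) :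
    FunctionSpaces.lowFreqCutoff 0 v =
      FunctionSpaces.lowFreqCutoff (-(n : ℤ)) v + ∑ i ∈ Finset.range n, FunctionSpaces.lpBlock (-(i : ℤ)) v := by
  induction n with
  | zero => simp
  | succ n ih =>
    have hblock : FunctionSpaces.lpBlock (-(n : ℤ)) v =
        FunctionSpaces.lowFreqCutoff (-(n : ℤ)) v - FunctionSpaces.lowFreqCutoff (-((n + 1 : ℕ) : ℤ)) v := by
      rw [FunctionSpaces.lpBlock_eq_sub_holds (-(n : ℤ)), show (-(n : ℤ)) - 1 = -((n + 1 : ℕ) : ℤ) by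
        push_cast; ring]
      rfl
    rw [Finset.sum_range_succ, hblock, ih]
    abel

variable [CompleteSpace F]

/-- Each block is controlled by the `Ḃ^s_{p,∞}` norm: `‖Δ̇_j u‖_{L^p} ≤ 2^{-js} ‖u‖_{Ḃ^s_{p,∞}}`
(BCD Def. 2.15: `2^{js} ‖Δ̇_j u‖_{L^p} ≤ sup_j 2^{js} ‖Δ̇_j u‖_{L^p}`). [folklore] -/
theorem eLpNormDistrib_lpBlock_le_two_rpow_mul_eHomBesovNorm (s : ℝ) (p : ℝ≥0∞) [Fact (1 ≤ p)]
    (u : 𝓢'(E, F)) (j : ℤ) :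
    FunctionSpaces.eLpNormDistrib p (FunctionSpaces.lpBlock j u) ≤ (2 : ℝ≥0∞) ^ (-((j : ℝ) * s)) * FunctionSpaces.eHomBesovNorm s p ∞ u := by
  have hw : FunctionSpaces.lpBlockWeight s p u j ≤ FunctionSpaces.eHomBesovNorm s p ∞ u := by
    rw [FunctionSpaces.eHomBesovNorm_top]
    exact le_iSup (fun j : ℤ => (2 : ℝ≥0∞) ^ ((j : ℝ) * s) * FunctionSpaces.eLpNormDistrib p (FunctionSpaces.lpBlock j u)) j
  calc FunctionSpaces.eLpNormDistrib p (FunctionSpaces.lpBlock j u)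
      = (2 : ℝ≥0∞) ^ (-((j : ℝ) * s)) * FunctionSpaces.lpBlockWeight s p u j := by
        rw [FunctionSpaces.lpBlockWeight, ← mul_assoc, FunctionSpaces.two_rpow_mul_two_rpow, neg_add_cancel, ENNReal.rpow_zero,
          one_mul]
    _ ≤ (2 : ℝ≥0∞) ^ (-((j : ℝ) * s)) * FunctionSpaces.eHomBesovNorm s p ∞ u := by gcongr

/-- The low-frequency blocks in `Ḃ^{-1}_{p,∞}`: `‖Δ̇_{-i} u‖_{L^p} ≤ 2^{-i} ‖u‖_{Ḃ^{-1}_{p,∞}}`,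
`i ∈ ℕ` (BCD Def. 2.15). [folklore] -/
theorem eLpNormDistrib_lpBlock_neg_le (p : ℝ≥0∞) [Fact (1 ≤ p)] (u : 𝓢'(E, F)) (i : ℕ) :
    FunctionSpaces.eLpNormDistrib p (FunctionSpaces.lpBlock (-(i : ℤ)) u) ≤ (2⁻¹ : ℝ≥0∞) ^ i * FunctionSpaces.eHomBesovNorm (-1) p ∞ u := by
  have h := eLpNormDistrib_lpBlock_le_two_rpow_mul_eHomBesovNorm (-1) p u (-(i : ℤ))
  have he : (2 : ℝ≥0∞) ^ (-(((-(i : ℤ) : ℤ) : ℝ) * (-1))) = (2⁻¹ : ℝ≥0∞) ^ i := by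
    rw [show (-(((-(i : ℤ) : ℤ) : ℝ) * (-1))) = -((i : ℕ) : ℝ) by push_cast; ring,
      ENNReal.rpow_neg, ENNReal.rpow_natCast, ENNReal.inv_pow]
  rwa [he] at h

/-- The geometric sum of the low-frequency blocks:
`∑_{i<n} ‖Δ̇_{-i} u‖_{L^p} ≤ (∑_{i ≥ 0} 2^{-i}) ‖u‖_{Ḃ^{-1}_{p,∞}} = 2 ‖u‖_{Ḃ^{-1}_{p,∞}}`
(BCD Def. 2.15; `ENNReal.tsum_geometric`). [folklore] -/
theorem sum_eLpNormDistrib_lpBlock_neg_le (p : ℝ≥0∞) [Fact (1 ≤ p)] (u : 𝓢'(E, F)) (n : ℕ) :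
    ∑ i ∈ Finset.range n, FunctionSpaces.eLpNormDistrib p (FunctionSpaces.lpBlock (-(i : ℤ)) u) ≤
      2 * FunctionSpaces.eHomBesovNorm (-1) p ∞ u := by
  calc ∑ i ∈ Finset.range n, FunctionSpaces.eLpNormDistrib p (FunctionSpaces.lpBlock (-(i : ℤ)) u)
      ≤ ∑ i ∈ Finset.range n, (2⁻¹ : ℝ≥0∞) ^ i * FunctionSpaces.eHomBesovNorm (-1) p ∞ u :=
        Finset.sum_le_sum fun i _ => eLpNormDistrib_lpBlock_neg_le p u i
    _ = (∑ i ∈ Finset.range n, (2⁻¹ : ℝ≥0∞) ^ i) * FunctionSpaces.eHomBesovNorm (-1) p ∞ u := by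
        rw [Finset.sum_mul]
    _ ≤ (∑' i : ℕ, (2⁻¹ : ℝ≥0∞) ^ i) * FunctionSpaces.eHomBesovNorm (-1) p ∞ u := by
        gcongr
        exact ENNReal.sum_le_tsum _
    _ = 2 * FunctionSpaces.eHomBesovNorm (-1) p ∞ u := by
        rw [ENNReal.tsum_geometric, ENNReal.one_sub_inv_two, inv_inv]

/-- Finite subadditivity of the distributional `L^p` norm (from `Literature.Analysis.FluidPDE.eLpNormDistrib_add_le`;
BCD §1.1). [folklore] -/
theorem eLpNormDistrib_sum_le {ι : Type*} (p : ℝ≥0∞) [Fact (1 ≤ p)] (s : Finset ι)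
    (g : ι → 𝓢'(E, F)) :
    FunctionSpaces.eLpNormDistrib p (∑ i ∈ s, g i) ≤ ∑ i ∈ s, FunctionSpaces.eLpNormDistrib p (g i) := by
  classical
  induction s using Finset.induction_on with
  | empty => rw [Finset.sum_empty, Finset.sum_empty, FunctionSpaces.eLpNormDistrib_zero]
  | insert a s ha ih =>
    rw [Finset.sum_insert ha, Finset.sum_insert ha]
    exact (eLpNormDistrib_add_le _ _).trans (by gcongr)

/-- **Telescoped bound on the low frequencies**:
`‖Ṡ₀ v‖_{L^p} ≤ ‖Ṡ_{-n} v‖_{L^p} + 2 ‖v‖_{Ḃ^{-1}_{p,∞}}` for every `n ∈ ℕ` (telescoping,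
triangle inequality, geometric sum; BCD §2.3). [folklore] -/
theorem eLpNormDistrib_lowFreqCutoff_zero_le_add (p : ℝ≥0∞) [Fact (1 ≤ p)] (v : 𝓢'(E, F))
    (n : ℕ) :
    FunctionSpaces.eLpNormDistrib p (FunctionSpaces.lowFreqCutoff 0 v) ≤
      FunctionSpaces.eLpNormDistrib p (FunctionSpaces.lowFreqCutoff (-(n : ℤ)) v) + 2 * FunctionSpaces.eHomBesovNorm (-1) p ∞ v := by
  rw [lowFreqCutoff_zero_eq_add_sum v n]
  calc FunctionSpaces.eLpNormDistrib p (FunctionSpaces.lowFreqCutoff (-(n : ℤ)) v + ∑ i ∈ Finset.range n, FunctionSpaces.lpBlock (-(i : ℤ)) v)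
      ≤ FunctionSpaces.eLpNormDistrib p (FunctionSpaces.lowFreqCutoff (-(n : ℤ)) v) +
          FunctionSpaces.eLpNormDistrib p (∑ i ∈ Finset.range n, FunctionSpaces.lpBlock (-(i : ℤ)) v) :=
        eLpNormDistrib_add_le _ _
    _ ≤ FunctionSpaces.eLpNormDistrib p (FunctionSpaces.lowFreqCutoff (-(n : ℤ)) v) +
          ∑ i ∈ Finset.range n, FunctionSpaces.eLpNormDistrib p (FunctionSpaces.lpBlock (-(i : ℤ)) v) := by
        gcongr
        exact eLpNormDistrib_sum_le p _ _
    _ ≤ FunctionSpaces.eLpNormDistrib p (FunctionSpaces.lowFreqCutoff (-(n : ℤ)) v) + 2 * FunctionSpaces.eHomBesovNorm (-1) p ∞ v := by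
        gcongr
        exact sum_eLpNormDistrib_lpBlock_neg_le p v n

/-- The high-frequency part of the inhomogeneous norm is bounded by the homogeneous norm:
`sup_{j ≥ 1} 2^{js} ‖Δ̇_j u‖_{L^p} ≤ sup_{j ∈ ℤ} 2^{js} ‖Δ̇_j u‖_{L^p}` (BCD Def. 2.15 / 2.68). [folklore] -/
theorem eLpNorm_lpBlockWeightSucc_top_le (s : ℝ) (p : ℝ≥0∞) [Fact (1 ≤ p)] (u : 𝓢'(E, F)) :
    eLpNorm (FunctionSpaces.lpBlockWeightSucc s p u) ∞ Measure.count ≤ FunctionSpaces.eHomBesovNorm s p ∞ u := by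
  rw [eLpNorm_exponent_top, eLpNormEssSup_count, FunctionSpaces.eHomBesovNorm, eLpNorm_exponent_top,
    eLpNormEssSup_count]
  exact iSup_le fun n => le_iSup (fun j : ℤ => ‖FunctionSpaces.lpBlockWeight s p u j‖ₑ) ((n : ℤ) + 1)

/-- The dyadic pieces `2^{js} ‖Δ̇_j v‖_{L^p}`, `j ≥ 1`, are bounded by the inhomogeneous norm
`‖v‖_{B^s_{p,∞}}` (BCD Def. 2.68). [folklore] -/
theorem lpBlockWeight_succ_le_eBesovNorm (s : ℝ) (p : ℝ≥0∞) [Fact (1 ≤ p)] (v : 𝓢'(E, F))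
    (n : ℕ) : FunctionSpaces.lpBlockWeight s p v ((n : ℤ) + 1) ≤ FunctionSpaces.eBesovNorm s p ∞ v := by
  rw [FunctionSpaces.eBesovNorm, eLpNorm_exponent_top, eLpNormEssSup_count]
  exact le_add_left (le_iSup (fun n : ℕ => ‖FunctionSpaces.lpBlockWeightSucc s p v n‖ₑ) n)

omit [MeasurableSpace E] [BorelSpace E] in
/-- Positivity of the Bernstein gain `d (1/q - 1/p)` for `1 ≤ q < p ≤ ∞` on a space of positive
dimension `d` (with `1/∞ = 0`). [folklore] -/
theorem finrank_mul_inv_sub_inv_pos [Nontrivial E] {q p : ℝ≥0∞} [hq : Fact (1 ≤ q)]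
    (hqp : q < p) : 0 < (Module.finrank ℝ E : ℝ) * (q.toReal⁻¹ - p.toReal⁻¹) := by
  have hd : (0 : ℝ) < Module.finrank ℝ E := by exact_mod_cast Module.finrank_pos (R := ℝ) (M := E)
  refine mul_pos hd (sub_pos.2 ?_)
  have hq0 : 0 < q.toReal := ENNReal.toReal_pos (zero_lt_one.trans_le hq.out).ne' hqp.ne_top
  rcases eq_or_ne p ∞ with rfl | hp
  · simpa using inv_pos.2 hq0
  · exact inv_strictAnti₀ hq0 ((ENNReal.toReal_lt_toReal hqp.ne_top hp).2 hqp)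

/-- **Low frequencies are controlled by the homogeneous norm for `L^q` data**: if `v ∈ L^q`
(`‖v‖_{L^q} < ∞`) for some `q < p`, then `‖Ṡ₀ v‖_{L^p} ≤ 2 ‖v‖_{Ḃ^{-1}_{p,∞}}` — from
`eLpNormDistrib_lowFreqCutoff_zero_le_add` and the low-frequency Bernstein inequality
`‖Ṡ_{-n} v‖_{L^p} ≤ C 2^{-n d (1/q - 1/p)} ‖v‖_{L^q} → 0` (`n → ∞`). This is the realisation
of `Ṡ₀ v` as `∑_{j ≤ 0} Δ̇_j v` for `L^q` distributions (BCD §2.3, the convergence of the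
low-frequency part of the homogeneous decomposition; Cheskidov–Shvydkoy 2010, p. 7: "the
homogeneous version of the Besov space is smaller than the nonhomogeneous one" for negative
regularity). False for `q = p` (constants). [folklore] -/
theorem eLpNormDistrib_lowFreqCutoff_zero_le_two_mul [Nontrivial E] {q p : ℝ≥0∞} [Fact (1 ≤ q)]
    [Fact (1 ≤ p)] (hqp : q < p) {v : 𝓢'(E, F)} (hv : FunctionSpaces.eLpNormDistrib q v ≠ ∞) :
    FunctionSpaces.eLpNormDistrib p (FunctionSpaces.lowFreqCutoff 0 v) ≤ 2 * FunctionSpaces.eHomBesovNorm (-1) p ∞ v := by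
  obtain ⟨C, -, hC⟩ := exists_eLpNormDistrib_lowFreqCutoff_le (E := E) (F := F) q p hqp.le
  set δ : ℝ := (Module.finrank ℝ E : ℝ) * (q.toReal⁻¹ - p.toReal⁻¹) with hδ
  have hδpos : 0 < δ := finrank_mul_inv_sub_inv_pos hqp
  set B := FunctionSpaces.eHomBesovNorm (-1) p ∞ v
  -- the geometric ratio `2^{-δ} < 1`
  have hr : (2 : ℝ≥0∞) ^ (-δ) < 1 :=
    ENNReal.rpow_lt_one_of_one_lt_of_neg (by norm_num) (neg_lt_zero.2 hδpos)
  have hpow : ∀ n : ℕ, (2 : ℝ≥0∞) ^ (-(n : ℝ) * δ) = ((2 : ℝ≥0∞) ^ (-δ)) ^ n := fun n => by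
    rw [show -(n : ℝ) * δ = -δ * n by ring, ENNReal.rpow_mul, ENNReal.rpow_natCast]
  have hlim : Tendsto
      (fun n : ℕ => (C : ℝ≥0∞) * (2 : ℝ≥0∞) ^ (-(n : ℝ) * δ) * FunctionSpaces.eLpNormDistrib q v + 2 * B)
      atTop (𝓝 ((C : ℝ≥0∞) * 0 * FunctionSpaces.eLpNormDistrib q v + 2 * B)) := by
    refine Tendsto.add ?_ tendsto_const_nhds
    refine ENNReal.Tendsto.mul_const (ENNReal.Tendsto.const_mul ?_ (Or.inr ENNReal.coe_ne_top))
      (Or.inr hv)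
    simp_rw [hpow]
    exact ENNReal.tendsto_pow_atTop_nhds_zero_of_lt_one hr
  rw [mul_zero, zero_mul, zero_add] at hlim
  refine ge_of_tendsto' hlim fun n => ?_
  calc FunctionSpaces.eLpNormDistrib p (FunctionSpaces.lowFreqCutoff 0 v)
      ≤ FunctionSpaces.eLpNormDistrib p (FunctionSpaces.lowFreqCutoff (-(n : ℤ)) v) + 2 * B :=
        eLpNormDistrib_lowFreqCutoff_zero_le_add p v n
    _ ≤ (C : ℝ≥0∞) * (2 : ℝ≥0∞) ^ (-(n : ℝ) * δ) * FunctionSpaces.eLpNormDistrib q v + 2 * B := by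
        gcongr
        have h := hC (-(n : ℤ)) v
        have he : (((-(n : ℤ) : ℤ)) : ℝ) * (Module.finrank ℝ E : ℝ) * (q.toReal⁻¹ - p.toReal⁻¹) =
            -(n : ℝ) * δ := by
          rw [hδ]; push_cast; ring
        rwa [he] at h

/-- **Inhomogeneous versus homogeneous `B^{-1}_{p,∞}` norm for `L^q` data**, `q < p`:
`‖v‖_{B^{-1}_{p,∞}} ≤ 3 ‖v‖_{Ḃ^{-1}_{p,∞}}` (`= 2 ‖v‖ + ‖v‖`: the low-frequency block by
`eLpNormDistrib_lowFreqCutoff_zero_le_two_mul`, the blocks `j ≥ 1` trivially). For `q = 2`,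
`p = ∞` on `ℝ³` this is the comparison claimed in the design notes of `CriticalRegularity.lean`
for increments of Leray–Hopf solutions (Cheskidov–Shvydkoy 2010, p. 7). [folklore] -/
theorem eBesovNorm_le_three_mul_eHomBesovNorm [Nontrivial E] {q p : ℝ≥0∞} [Fact (1 ≤ q)]
    [Fact (1 ≤ p)] (hqp : q < p) {v : 𝓢'(E, F)} (hv : FunctionSpaces.eLpNormDistrib q v ≠ ∞) :
    FunctionSpaces.eBesovNorm (-1) p ∞ v ≤ 3 * FunctionSpaces.eHomBesovNorm (-1) p ∞ v := by
  rw [FunctionSpaces.eBesovNorm]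
  calc FunctionSpaces.eLpNormDistrib p (FunctionSpaces.lowFreqCutoff 0 v) + eLpNorm (FunctionSpaces.lpBlockWeightSucc (-1) p v) ∞ Measure.count
      ≤ 2 * FunctionSpaces.eHomBesovNorm (-1) p ∞ v + FunctionSpaces.eHomBesovNorm (-1) p ∞ v :=
        add_le_add (eLpNormDistrib_lowFreqCutoff_zero_le_two_mul hqp hv)
          (eLpNorm_lpBlockWeightSucc_top_le (-1) p v)
    _ = 3 * FunctionSpaces.eHomBesovNorm (-1) p ∞ v := by ring

end LowFreqComparison

/-! ## The dyadic tail `φ` and the left-neighbourhood lemma of the proof of Thm. 3.1 -/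

section DyadicTail

variable {E F : Type*} [NormedAddCommGroup E] [InnerProductSpace ℝ E] [FiniteDimensional ℝ E]
  [MeasurableSpace E] [BorelSpace E] [NormedAddCommGroup F] [NormedSpace ℂ F] [CompleteSpace F]

/-- Subadditivity of `limsup` in `ℝ≥0∞` along an arbitrary filter:
`limsup (u + v) ≤ limsup u + limsup v` (Mathlib's `ENNReal.limsup_add_le` asks for a
`CountableInterFilter`, which `atTop` on `ℕ` is not; here: for `a > limsup u`, `b > limsup v`,
eventually `u + v < a + b`). [folklore] -/
theorem ennreal_limsup_add_le {ι : Type*} (f : Filter ι) (u v : ι → ℝ≥0∞) :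
    limsup (fun i => u i + v i) f ≤ limsup u f + limsup v f := by
  have key : ∀ a, limsup u f < a → ∀ b, limsup v f < b →
      limsup (fun i => u i + v i) f ≤ a + b := by
    intro a ha b hb
    refine limsup_le_of_le (by isBoundedDefault) ?_
    filter_upwards [eventually_lt_of_limsup_lt ha, eventually_lt_of_limsup_lt hb] with i hi hi'
    exact add_le_add hi.le hi'.le
  rcases eq_or_ne (limsup u f) ∞ with hu | hu
  · rw [hu, top_add]; exact le_top
  rcases eq_or_ne (limsup v f) ∞ with hv | hv
  · rw [hv, add_top]; exact le_top
  refine ENNReal.le_of_forall_pos_le_add fun ε hε _ => ?_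
  have hε2 : (0 : ℝ≥0∞) < ε / 2 := by simpa using hε.ne'
  calc limsup (fun i => u i + v i) f
      ≤ (limsup u f + ε / 2) + (limsup v f + ε / 2) :=
        key _ (ENNReal.lt_add_right hu hε2.ne') _ (ENNReal.lt_add_right hv hε2.ne')
    _ = limsup u f + limsup v f + ε := by
        rw [add_add_add_comm, ENNReal.add_halves]

/-- The **dyadic tail** `φ_{s,p}(v) = limsup_{j → +∞} 2^{js} ‖Δ̇_j v‖_{L^p} ∈ [0, ∞]` of a tempered
distribution (Cheskidov–Shvydkoy 2010, proof of Thm. 3.1, p. 6: `φ(t) = limsup_{q → ∞}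
λ_q⁻¹ ‖u_q(t)‖_∞`, which is `2 φ_{-1,∞}(u(t))` in the conventions of `LittlewoodPaley.lean`; it
vanishes exactly when the high frequencies of `v` are `o(2^{-js})` in `L^p`, e.g. for `H¹` data
at `s = -1`, `p = ∞` on `ℝ³`). [cite: CheskidovShvydkoy2010, proof of Thm. 3.1] -/
def dyadicTail (s : ℝ) (p : ℝ≥0∞) [Fact (1 ≤ p)] (v : 𝓢'(E, F)) : ℝ≥0∞ :=
  limsup (fun j : ℕ => FunctionSpaces.lpBlockWeight s p v (j : ℤ)) atTop

/-- The dyadic tail is dominated by the inhomogeneous norm: `φ_{s,p}(v) ≤ ‖v‖_{B^s_{p,∞}}`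
(only the blocks `j ≥ 1` matter in the `limsup`; BCD Def. 2.68). [folklore] -/
theorem dyadicTail_le_eBesovNorm (s : ℝ) (p : ℝ≥0∞) [Fact (1 ≤ p)] (v : 𝓢'(E, F)) :
    dyadicTail s p v ≤ FunctionSpaces.eBesovNorm s p ∞ v := by
  refine limsup_le_of_le (by isBoundedDefault) ?_
  filter_upwards [eventually_ge_atTop 1] with j hj
  obtain ⟨n, rfl⟩ : ∃ n : ℕ, j = n + 1 := ⟨j - 1, by omega⟩
  push_cast
  exact lpBlockWeight_succ_le_eBesovNorm s p v n

/-- The dyadic tail is subadditive: `φ(u + v) ≤ φ(u) + φ(v)` (the blocks are linear,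
`Literature.Analysis.FluidPDE.lpBlockWeight_add_le`, and `limsup` is subadditive). [folklore] -/
theorem dyadicTail_add_le (s : ℝ) (p : ℝ≥0∞) [Fact (1 ≤ p)] (u v : 𝓢'(E, F)) :
    dyadicTail s p (u + v) ≤ dyadicTail s p u + dyadicTail s p v := by
  unfold dyadicTail
  calc limsup (fun j : ℕ => FunctionSpaces.lpBlockWeight s p (u + v) (j : ℤ)) atTop
      ≤ limsup (fun j : ℕ => FunctionSpaces.lpBlockWeight s p u (j : ℤ) + FunctionSpaces.lpBlockWeight s p v (j : ℤ)) atTop :=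
        limsup_le_limsup (Eventually.of_forall fun j => lpBlockWeight_add_le s p u v (j : ℤ))
    _ ≤ _ := ennreal_limsup_add_le _ _ _

/-- The dyadic tail is even: `φ(-v) = φ(v)` (`Literature.Analysis.FluidPDE.lpBlockWeight_neg`). [folklore] -/
theorem dyadicTail_neg (s : ℝ) (p : ℝ≥0∞) [Fact (1 ≤ p)] (v : 𝓢'(E, F)) :
    dyadicTail s p (-v) = dyadicTail s p v := by
  simp only [dyadicTail, lpBlockWeight_neg]

/-- Triangle inequality for the dyadic tail in difference form: `φ(u) ≤ φ(v) + φ(u - v)`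
(Cheskidov–Shvydkoy 2010, proof of Thm. 3.1: `φ(β) ≤ φ(t₀) + ‖u(β) - u(t₀)‖`). [folklore] -/
theorem dyadicTail_le_add_sub (s : ℝ) (p : ℝ≥0∞) [Fact (1 ≤ p)] (u v : 𝓢'(E, F)) :
    dyadicTail s p u ≤ dyadicTail s p v + dyadicTail s p (u - v) := by
  simpa only [add_sub_cancel] using dyadicTail_add_le s p v (u - v)

/-- The inhomogeneous Besov norm is even: `‖-v‖_{B^s_{p,q}} = ‖v‖_{B^s_{p,q}}` (`Ṡ₀` is linear and
the block weights are even; BCD Def. 2.68). [folklore] -/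
theorem eBesovNorm_neg (s : ℝ) (p q : ℝ≥0∞) [Fact (1 ≤ p)] (v : 𝓢'(E, F)) :
    FunctionSpaces.eBesovNorm s p q (-v) = FunctionSpaces.eBesovNorm s p q v := by
  have h : FunctionSpaces.lpBlockWeightSucc s p (-v) = FunctionSpaces.lpBlockWeightSucc s p v := by
    ext n; simp [FunctionSpaces.lpBlockWeightSucc, lpBlockWeight_neg]
  simp only [FunctionSpaces.eBesovNorm, map_neg, eLpNormDistrib_neg, h]

/-- `‖u - v‖_{B^s_{p,q}} = ‖v - u‖_{B^s_{p,q}}` (BCD Def. 2.68). [folklore] -/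
theorem eBesovNorm_sub_comm (s : ℝ) (p q : ℝ≥0∞) [Fact (1 ≤ p)] (u v : 𝓢'(E, F)) :
    FunctionSpaces.eBesovNorm s p q (u - v) = FunctionSpaces.eBesovNorm s p q (v - u) := by
  rw [← neg_sub, eBesovNorm_neg]

/-- A block of `u` against the same block of a reference `v`, `j ≥ 1`:
`2^{js} ‖Δ̇_j u‖_p ≤ 2^{js} ‖Δ̇_j v‖_p + ‖v - u‖_{B^s_{p,∞}}` (Cheskidov–Shvydkoy 2010, proof of
Thm. 3.1: `λ_q⁻¹‖u_q(s)‖_∞ ≤ λ_q⁻¹‖u_q(β)‖_∞ + ‖u(s) - u(β)‖_{B^{-1}_{∞,∞}}`). [folklore] -/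
theorem lpBlockWeight_le_add_eBesovNorm_sub (s : ℝ) (p : ℝ≥0∞) [Fact (1 ≤ p)] (u v : 𝓢'(E, F))
    (n : ℕ) :
    FunctionSpaces.lpBlockWeight s p u ((n : ℤ) + 1) ≤
      FunctionSpaces.lpBlockWeight s p v ((n : ℤ) + 1) + FunctionSpaces.eBesovNorm s p ∞ (v - u) := by
  calc FunctionSpaces.lpBlockWeight s p u ((n : ℤ) + 1)
      ≤ FunctionSpaces.lpBlockWeight s p v ((n : ℤ) + 1) + FunctionSpaces.lpBlockWeight s p (u - v) ((n : ℤ) + 1) := by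
        simpa only [add_sub_cancel] using lpBlockWeight_add_le s p v (u - v) ((n : ℤ) + 1)
    _ ≤ FunctionSpaces.lpBlockWeight s p v ((n : ℤ) + 1) + FunctionSpaces.eBesovNorm s p ∞ (u - v) := by
        gcongr; exact lpBlockWeight_succ_le_eBesovNorm s p (u - v) n
    _ = _ := by rw [eBesovNorm_sub_comm]

/-- **The left-neighbourhood lemma** (Cheskidov–Shvydkoy 2010, proof of Thm. 3.1, p. 6, for an
arbitrary time family of distributions `U`). If the left jumps of `U` at `β` are eventually
small, `limsup_{t₀ → β⁻} ‖U β - U t₀‖_{B^{-1}_{∞,∞}} < c`, and the dyadic tail vanishes at times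
`t₀` arbitrarily close to `β` from the left (`φ(U t₀) = 0` frequently; in CS: at every time of an
interval of regularity, where `u(t₀) ∈ C^∞`), then there is `t₁ < β` with
`limsup_{j → ∞} sup_{s ∈ (t₁, β)} 2^{-j} ‖Δ̇_j U(s)‖_∞ < 2c` — the hypothesis of Lemma 3.2
(`NS.cheskidov_shvydkoy_dyadic`) on `(t₁, β)` with twice the constant. Proof as printed: pick
`c' ∈ (limsup, c)`; `φ(U β) ≤ φ(U t₀) + ‖U β - U t₀‖ ≤ c'` for a good `t₀`; on a left
neighbourhood where the jumps are `< c'`,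
`2^{-j}‖Δ̇_j U(s)‖_∞ ≤ 2^{-j}‖Δ̇_j U(β)‖_∞ + c'` for `j ≥ 1`, whose `limsup_j` is
`φ(U β) + c' ≤ 2c' < 2c`. [cite: CheskidovShvydkoy2010, proof of Thm. 3.1] -/
theorem exists_limsup_biSup_lpBlockWeight_lt {U : ℝ → 𝓢'(E, F)} {β : ℝ} {c : ℝ≥0∞}
    (hjump : limsup (fun t₀ => FunctionSpaces.eBesovNorm (-1) ∞ ∞ (U β - U t₀)) (𝓝[<] β) < c)
    (htail : ∃ᶠ t₀ in 𝓝[<] β, dyadicTail (-1) ∞ (U t₀) = 0) :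
    ∃ t₁ < β, limsup (fun j : ℕ => ⨆ s ∈ Ioo t₁ β, FunctionSpaces.lpBlockWeight (-1) ∞ (U s) (j : ℤ)) atTop <
      2 * c := by
  -- a margin `c' < c`
  obtain ⟨c', hc', hc'c⟩ := exists_between hjump
  -- eventually (from the left) the jumps are `< c'`
  have hev : ∀ᶠ t₀ in 𝓝[<] β, FunctionSpaces.eBesovNorm (-1) ∞ ∞ (U β - U t₀) < c' :=
    eventually_lt_of_limsup_lt hc'
  -- the tail at `β` is at most `c'`
  have hφβ : dyadicTail (-1) ∞ (U β) ≤ c' := by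
    obtain ⟨t₀, hφ₀, ht₀⟩ := (htail.and_eventually hev).exists
    calc dyadicTail (-1) ∞ (U β)
        ≤ dyadicTail (-1) ∞ (U t₀) + dyadicTail (-1) ∞ (U β - U t₀) :=
          dyadicTail_le_add_sub _ _ _ _
      _ ≤ 0 + FunctionSpaces.eBesovNorm (-1) ∞ ∞ (U β - U t₀) := by
          rw [hφ₀]; gcongr; exact dyadicTail_le_eBesovNorm _ _ _
      _ ≤ c' := by rw [zero_add]; exact ht₀.le
  -- a left neighbourhood `(t₁, β)` on which the jumps are `< c'`
  obtain ⟨t₁, ht₁β, ht₁⟩ : ∃ t₁ < β, ∀ s ∈ Ioo t₁ β, FunctionSpaces.eBesovNorm (-1) ∞ ∞ (U β - U s) < c' := by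
    rcases (mem_nhdsLT_iff_exists_Ioo_subset).1 hev with ⟨t₁, ht₁β, hsub⟩
    exact ⟨t₁, ht₁β, fun s hs => hsub hs⟩
  refine ⟨t₁, ht₁β, ?_⟩
  -- bound the supremum for `j ≥ 1` by `2^{-j}‖Δ̇_j U(β)‖_∞ + c'`
  have hle : limsup (fun j : ℕ => ⨆ s ∈ Ioo t₁ β, FunctionSpaces.lpBlockWeight (-1) ∞ (U s) (j : ℤ)) atTop ≤
      limsup (fun j : ℕ => FunctionSpaces.lpBlockWeight (-1) ∞ (U β) (j : ℤ) + c') atTop := by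
    refine limsup_le_limsup ?_
    filter_upwards [eventually_ge_atTop 1] with j hj
    obtain ⟨n, rfl⟩ : ∃ n : ℕ, j = n + 1 := ⟨j - 1, by omega⟩
    push_cast
    refine iSup₂_le fun s hs => ?_
    calc FunctionSpaces.lpBlockWeight (-1) ∞ (U s) ((n : ℤ) + 1)
        ≤ FunctionSpaces.lpBlockWeight (-1) ∞ (U β) ((n : ℤ) + 1) + FunctionSpaces.eBesovNorm (-1) ∞ ∞ (U β - U s) :=
          lpBlockWeight_le_add_eBesovNorm_sub _ _ _ _ _
      _ ≤ FunctionSpaces.lpBlockWeight (-1) ∞ (U β) ((n : ℤ) + 1) + c' := by gcongr; exact (ht₁ s hs).le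
  calc limsup (fun j : ℕ => ⨆ s ∈ Ioo t₁ β, FunctionSpaces.lpBlockWeight (-1) ∞ (U s) (j : ℤ)) atTop
      ≤ limsup (fun j : ℕ => FunctionSpaces.lpBlockWeight (-1) ∞ (U β) (j : ℤ) + c') atTop := hle
    _ = dyadicTail (-1) ∞ (U β) + c' := by
        rw [dyadicTail]
        exact limsup_add_const atTop _ c' (by isBoundedDefault) (by isBoundedDefault)
    _ ≤ c' + c' := by gcongr
    _ < c + c := ENNReal.add_lt_add hc'c hc'c
    _ = 2 * c := (two_mul c).symm

/-- **Blocks are bounded from `L^q` to `L^r` with the low-frequency gain**: given the constant of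
`exists_eLpNormDistrib_lowFreqCutoff_le q r`, for every `j ∈ ℕ`
`‖Δ̇_j v‖_{L^r} ≤ 2 C 2^{j d (1/q - 1/r)} ‖v‖_{L^q}` (`Δ̇_j = Ṡ_j - Ṡ_{j-1}` and
`2^{(j-1)θ} ≤ 2^{jθ}` for the nonnegative gain `θ = d (1/q - 1/r)`; BCD Lemma 2.1). [folklore] -/
theorem eLpNormDistrib_lpBlock_nat_le {q r : ℝ≥0∞} [Fact (1 ≤ q)] [Fact (1 ≤ r)] (hqr : q ≤ r)
    {C : ℝ≥0}
    (hC : ∀ (k : ℤ) (u : 𝓢'(E, F)), FunctionSpaces.eLpNormDistrib r (FunctionSpaces.lowFreqCutoff k u) ≤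
        C * (2 : ℝ≥0∞) ^ ((k : ℝ) * Module.finrank ℝ E * (q.toReal⁻¹ - r.toReal⁻¹)) *
          FunctionSpaces.eLpNormDistrib q u)
    (v : 𝓢'(E, F)) (j : ℕ) :
    FunctionSpaces.eLpNormDistrib r (FunctionSpaces.lpBlock (j : ℤ) v) ≤
      2 * C * (2 : ℝ≥0∞) ^ ((j : ℝ) * (Module.finrank ℝ E * (q.toReal⁻¹ - r.toReal⁻¹))) *
        FunctionSpaces.eLpNormDistrib q v := by
  set θ : ℝ := Module.finrank ℝ E * (q.toReal⁻¹ - r.toReal⁻¹) with hθ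
  have hθ0 : 0 ≤ θ := by
    refine mul_nonneg (Nat.cast_nonneg _) (sub_nonneg.2 ?_)
    rcases eq_or_ne r ∞ with rfl | hr
    · simp
    · have hq : q ≠ ∞ := ne_top_of_le_ne_top hr hqr
      have hq0 : 0 < q.toReal :=
        ENNReal.toReal_pos (zero_lt_one.trans_le (Fact.out : 1 ≤ q)).ne' hq
      exact inv_anti₀ hq0 ((ENNReal.toReal_le_toReal hq hr).2 hqr)
  have hS : ∀ k : ℤ, (k : ℝ) ≤ j → FunctionSpaces.eLpNormDistrib r (FunctionSpaces.lowFreqCutoff k v) ≤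
      C * (2 : ℝ≥0∞) ^ ((j : ℝ) * θ) * FunctionSpaces.eLpNormDistrib q v := by
    intro k hk
    refine (hC k v).trans ?_
    have hexp : (k : ℝ) * Module.finrank ℝ E * (q.toReal⁻¹ - r.toReal⁻¹) ≤ (j : ℝ) * θ := by
      rw [mul_assoc, ← hθ]; exact mul_le_mul_of_nonneg_right hk hθ0
    exact mul_le_mul' (mul_le_mul' le_rfl
      (ENNReal.rpow_le_rpow_of_exponent_le one_le_two hexp)) le_rfl
  rw [FunctionSpaces.lpBlock_eq_sub_holds (j : ℤ)]
  change FunctionSpaces.eLpNormDistrib r (FunctionSpaces.lowFreqCutoff (j : ℤ) v - FunctionSpaces.lowFreqCutoff ((j : ℤ) - 1) v) ≤ _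
  rw [sub_eq_add_neg]
  calc FunctionSpaces.eLpNormDistrib r (FunctionSpaces.lowFreqCutoff (j : ℤ) v + -FunctionSpaces.lowFreqCutoff ((j : ℤ) - 1) v)
      ≤ FunctionSpaces.eLpNormDistrib r (FunctionSpaces.lowFreqCutoff (j : ℤ) v) +
          FunctionSpaces.eLpNormDistrib r (-FunctionSpaces.lowFreqCutoff ((j : ℤ) - 1) v) := eLpNormDistrib_add_le _ _
    _ = FunctionSpaces.eLpNormDistrib r (FunctionSpaces.lowFreqCutoff (j : ℤ) v) +
          FunctionSpaces.eLpNormDistrib r (FunctionSpaces.lowFreqCutoff ((j : ℤ) - 1) v) := by rw [eLpNormDistrib_neg]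
    _ ≤ C * (2 : ℝ≥0∞) ^ ((j : ℝ) * θ) * FunctionSpaces.eLpNormDistrib q v +
          C * (2 : ℝ≥0∞) ^ ((j : ℝ) * θ) * FunctionSpaces.eLpNormDistrib q v :=
        add_le_add (hS j (by simp)) (hS (j - 1) (by push_cast; linarith))
    _ = 2 * C * (2 : ℝ≥0∞) ^ ((j : ℝ) * θ) * FunctionSpaces.eLpNormDistrib q v := by ring

/-- **Vanishing dyadic tail for `L^q` data, `q > d`**: if `v ∈ L^q` (`‖v‖_{L^q} < ∞`) with
`d / q < 1` (`d = dim E`; `q = ∞` allowed), then `φ_{-1,∞}(v) = limsup_j 2^{-j} ‖Δ̇_j v‖_∞ = 0`,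
because `2^{-j} ‖Δ̇_j v‖_∞ ≤ 2C 2^{-j(1 - d/q)} ‖v‖_{L^q} → 0` (Bernstein; this is the step
"`u(t) ∈ C^∞(ℝ³)`, hence `φ(t) = 0`" of Cheskidov–Shvydkoy 2010, proof of Thm. 3.1, p. 6, for
which `u(t) ∈ L⁶(ℝ³)` already suffices). [folklore] -/
theorem dyadicTail_eq_zero_of_eLpNormDistrib_ne_top {q : ℝ≥0∞} [Fact (1 ≤ q)]
    (hq : (Module.finrank ℝ E : ℝ) * q.toReal⁻¹ < 1) {v : 𝓢'(E, F)}
    (hv : FunctionSpaces.eLpNormDistrib q v ≠ ∞) : dyadicTail (-1) ∞ v = 0 := by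
  obtain ⟨C, -, hC⟩ := exists_eLpNormDistrib_lowFreqCutoff_le (E := E) (F := F) q ∞ le_top
  set θ : ℝ := Module.finrank ℝ E * (q.toReal⁻¹ - (∞ : ℝ≥0∞).toReal⁻¹) with hθ
  have hθ1 : θ < 1 := by simpa [hθ] using hq
  -- the bound `w_j ≤ 2C ‖v‖_q · (2^{θ-1})^j`
  have hw : ∀ j : ℕ, FunctionSpaces.lpBlockWeight (-1) ∞ v (j : ℤ) ≤
      2 * C * FunctionSpaces.eLpNormDistrib q v * ((2 : ℝ≥0∞) ^ (θ - 1)) ^ j := by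
    intro j
    have hb := eLpNormDistrib_lpBlock_nat_le (le_top : q ≤ ∞) hC v j
    rw [← hθ] at hb
    calc FunctionSpaces.lpBlockWeight (-1) ∞ v (j : ℤ)
        = (2 : ℝ≥0∞) ^ (((j : ℤ) : ℝ) * (-1)) * FunctionSpaces.eLpNormDistrib ∞ (FunctionSpaces.lpBlock (j : ℤ) v) := rfl
      _ ≤ (2 : ℝ≥0∞) ^ (((j : ℤ) : ℝ) * (-1)) *
            (2 * C * (2 : ℝ≥0∞) ^ ((j : ℝ) * θ) * FunctionSpaces.eLpNormDistrib q v) := by gcongr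
      _ = 2 * C * FunctionSpaces.eLpNormDistrib q v *
            ((2 : ℝ≥0∞) ^ (((j : ℤ) : ℝ) * (-1)) * (2 : ℝ≥0∞) ^ ((j : ℝ) * θ)) := by ring
      _ = 2 * C * FunctionSpaces.eLpNormDistrib q v * ((2 : ℝ≥0∞) ^ (θ - 1)) ^ j := by
          rw [FunctionSpaces.two_rpow_mul_two_rpow, ← ENNReal.rpow_natCast, ← ENNReal.rpow_mul]
          congr 2
          push_cast
          ring
  have hr : (2 : ℝ≥0∞) ^ (θ - 1) < 1 :=
    ENNReal.rpow_lt_one_of_one_lt_of_neg (by norm_num) (by linarith)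
  have hlim : Tendsto (fun j : ℕ => 2 * C * FunctionSpaces.eLpNormDistrib q v * ((2 : ℝ≥0∞) ^ (θ - 1)) ^ j)
      atTop (𝓝 (2 * C * FunctionSpaces.eLpNormDistrib q v * 0)) :=
    ENNReal.Tendsto.const_mul (ENNReal.tendsto_pow_atTop_nhds_zero_of_lt_one hr)
      (Or.inr (ENNReal.mul_ne_top (ENNReal.mul_ne_top (by simp) ENNReal.coe_ne_top) hv))
  rw [mul_zero] at hlim
  refine le_antisymm ?_ bot_le
  calc dyadicTail (-1) ∞ v
      ≤ limsup (fun j : ℕ => 2 * C * FunctionSpaces.eLpNormDistrib q v * ((2 : ℝ≥0∞) ^ (θ - 1)) ^ j) atTop :=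
        limsup_le_limsup (Eventually.of_forall hw)
    _ = 0 := hlim.limsup_eq

/-- **A.e. on `(0, T)` implies frequently from the left** at every `β ∈ (0, T]`: a property of
a.e. time is enjoyed at times arbitrarily close to `β` from below (every interval
`(a, β) ∩ (0, T)` has positive Lebesgue measure). [folklore] -/
theorem frequently_nhdsLT_of_ae_Ioo {T β : ℝ} {P : ℝ → Prop} (hβ : β ∈ Ioc 0 T)
    (h : ∀ᵐ t ∂(volume.restrict (Ioo 0 T)), P t) : ∃ᶠ t in 𝓝[<] β, P t := by
  rw [(nhdsLT_basis β).frequently_iff]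
  intro a ha
  set a' := max a 0 with ha'
  have ha'β : a' < β := max_lt ha hβ.1
  by_contra hne
  push Not at hne
  have h' : ∀ᵐ t ∂(volume.restrict (Ioo a' β)), P t :=
    ae_mono (Measure.restrict_mono
      (Ioo_subset_Ioo (le_max_right a 0) hβ.2) le_rfl) h
  have hfalse : ∀ᵐ t ∂(volume.restrict (Ioo a' β)), False := by
    filter_upwards [h', ae_restrict_mem measurableSet_Ioo] with t ht ht'
    exact hne t ⟨(le_max_left a 0).trans_lt ht'.1, ht'.2⟩ ht
  rw [eventually_false_iff_eq_bot, ae_eq_bot, Measure.restrict_eq_zero, Real.volume_Ioo,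
    ENNReal.ofReal_eq_zero] at hfalse
  linarith

end DyadicTail

end Literature.Analysis.FluidPDE

/-! ## Cheskidov–Shvydkoy: the printed statements and the reduction -/

namespace Literature.Analysis.FluidPDE

section Distribution

variable {ι : Type*} [Fintype ι] {E : Type*} [NormedAddCommGroup E] [InnerProductSpace ℝ E]
  [FiniteDimensional ℝ E] [MeasurableSpace E] [BorelSpace E]

/-- **An `L^p` field is its own distribution.** If `U` is the tempered distribution of
`u₀ : E → ℝ^ι` (`IsDistributionOf u₀ U`) and `u₀ ∈ L^p`, `1 ≤ p`, then `U` is Mathlib's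
embedding `Lp.toTemperedDistribution` of the `L^p` class of `complexify ∘ u₀` (the accepted
`NS.isDistributionOf_toTemperedDistribution` and uniqueness `NS.IsDistributionOf.unique`;
BCD §1.2, `L^p ⊂ 𝓢'`). [folklore] -/
theorem IsDistributionOf.coe_toLp {p : ℝ≥0∞} [Fact (1 ≤ p)] {u₀ : E → EuclideanSpace ℝ ι}
    {U : 𝓢'(E, EuclideanSpace ℂ ι)} (hU : IsDistributionOf u₀ U) (hu : MemLp u₀ p volume) :
    (((memLp_complexify_comp hu).toLp _ : Lp (EuclideanSpace ℂ ι) p (volume : Measure E)) :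
      𝓢'(E, EuclideanSpace ℂ ι)) = U :=
  ((isDistributionOf_toTemperedDistribution hu).unique hU)

/-- Increments of `L^p` fields are `L^p` distributions: if `U`, `V` are the distributions of
`u₀, v₀ ∈ L^p` then `‖U - V‖_{L^p} < ∞` for the distributional norm `Literature.Analysis.FunctionSpaces.eLpNormDistrib`
(BCD §1.2). [folklore] -/
theorem IsDistributionOf.eLpNormDistrib_sub_ne_top {p : ℝ≥0∞} [Fact (1 ≤ p)]
    {u₀ v₀ : E → EuclideanSpace ℝ ι} {U V : 𝓢'(E, EuclideanSpace ℂ ι)}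
    (hU : IsDistributionOf u₀ U) (hV : IsDistributionOf v₀ V) (hu : MemLp u₀ p volume)
    (hv : MemLp v₀ p volume) : FunctionSpaces.eLpNormDistrib p (U - V) ≠ ∞ := by
  rw [← hU.coe_toLp hu, ← hV.coe_toLp hv, ← Lp.toTemperedDistributionCLM_apply,
    ← Lp.toTemperedDistributionCLM_apply, ← map_sub, Lp.toTemperedDistributionCLM_apply]
  exact ((FunctionSpaces.eLpNormDistrib_coe_le _).trans_lt enorm_lt_top).ne

end Distribution

/-- Local notation for physical space `ℝ³ = EuclideanSpace ℝ (Fin 3)`. -/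
local notation "ℝ³" => EuclideanSpace ℝ (Fin 3)

/-- Local notation for the complexified target `ℂ³ = EuclideanSpace ℂ (Fin 3)`. -/
local notation "ℂ³" => EuclideanSpace ℂ (Fin 3)

/-- **ns.S31, as printed** (Cheskidov–Shvydkoy, Arch. Ration. Mech. Anal. 195 (2010), Thm. 3.1,
p. 5 of arXiv:0708.3067: "Let `u(t)` be a Leray–Hopf solution of (NSE) on `[0,T]`. If
`sup_{t ∈ (0,T]} limsup_{t₀ → t-} ‖u(t) - u(t₀)‖_{B^{-1}_{∞,∞}} < cν`, where `c > 0` is some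
absolute constant, then `u(t)` is regular on `(0,T]`"). Identical to the accepted
`NS.cheskidov_shvydkoy` except that the jumps are measured, as in the paper (§2.1, p. 4:
`‖u‖_{B^s_{p,∞}} = sup_{q ≥ -1} λ_q^s ‖u_q‖_p`, `u_{-1} = χ(D) u`), in the **inhomogeneous**
space `B^{-1}_{∞,∞}`, through the accepted `Literature.eBesovNorm (-1) ∞ ∞` (`= ‖Ṡ₀ ·‖_∞ +
sup_{j ≥ 1} 2^{-j} ‖Δ̇_j ·‖_∞`; CS's `u_q` is `Δ̇_{q+1}` and `u_{-1} = Ṡ₀`, so CS's norm is at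
most `2 · eBesovNorm (-1) ∞ ∞` and the printed constant `c` becomes `c / 2` — the constant is
existential, see the module docstring, §Conventions). Hypotheses: `ν > 0`, `u` a Leray–Hopf
weak solution of the unforced system on `ℝ³ × [0, T)` (`Fluid.IsLerayHopfOn`, at least as strong
as CS Def. 2.3), `U t` the tempered distribution of the slice `u t`, `t ∈ [0, T]`. Conclusion:
"regular on `(0, T]`" (CS: `‖u(t)‖_{H¹}` continuous on `(0, T]`) in the house rendering of
ns.S07 / `NS.cheskidov_shvydkoy`: a classical solution `(v, p')` on the time set `Ioc 0 T`
with `u(t) = v(t)` a.e. for every `t ∈ (0, T]`. [cite: CheskidovShvydkoy2010, Thm. 3.1] -/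
def cheskidov_shvydkoy_inhom : Prop :=
  ∃ c : ℝ, 0 < c ∧ ∀ (ν T : ℝ), 0 < ν → 0 < T → ∀ (u₀ : ℝ³ → ℝ³) (u : ℝ → ℝ³ → ℝ³)
      (U : ℝ → 𝓢'(ℝ³, ℂ³)), FluidPDE.IsLerayHopfOn T ν 0 u₀ u →
      (∀ t ∈ Icc 0 T, IsDistributionOf (u t) (U t)) →
      (⨆ t ∈ Ioc 0 T, limsup (fun t₀ => FunctionSpaces.eBesovNorm (-1) ∞ ∞ (U t - U t₀)) (𝓝[<] t)) <
        ENNReal.ofReal (c * ν) →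
      ∃ (v : ℝ → ℝ³ → ℝ³) (p' : ℝ → ℝ³ → ℝ),
        FluidPDE.IsClassicalNSSolutionOn (Ioc 0 T) ν 0 v p' ∧ ∀ t ∈ Ioc 0 T, u t =ᵐ[volume] v t

/-- **Cheskidov–Shvydkoy's dyadic regularity criterion** (Arch. Ration. Mech. Anal. 195 (2010),
Lemma 3.2, p. 5 of arXiv:0708.3067: "Let `u(t)` be a Leray–Hopf solution of (NSE) on `[0,T]`.
There is a constant `c > 0` such that if `limsup_{q → ∞} sup_{t ∈ (0,T)} λ_q⁻¹ ‖u_q(t)‖_∞ < cν`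
then `u(t)` is regular on `(0,T]`"), the crucial ingredient of Thm. 3.1. In the conventions of
`LittlewoodPaley.lean` (`u_q = Δ̇_{q+1} U`, `λ_q⁻¹ = 2 · 2^{-(q+1)}`) the dyadic quantity
`λ_q⁻¹ ‖u_q(t)‖_∞` is `2 · lpBlockWeight (-1) ∞ (U t) (q + 1)`, so the hypothesis reads
`limsup_{j → ∞} sup_{t ∈ (0,T)} 2^{-j} ‖Δ̇_j U(t)‖_∞ < c ν` up to the (existential) constant;
the supremum is over the open interval `(0, T)` as printed. The constant is absolute (proof of
Lemma 3.2, p. 5: `c = 1/C` with "`C > 0` an absolute constant independent of `u`"), whence the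
leading `∃ c`. Same solution class, distributions `U t` of the slices and house rendering of
"regular on `(0, T]`" as `cheskidov_shvydkoy_inhom`. [cite: CheskidovShvydkoy2010, Lemma 3.2] -/
def cheskidov_shvydkoy_dyadic : Prop :=
  ∃ c : ℝ, 0 < c ∧ ∀ (ν T : ℝ), 0 < ν → 0 < T → ∀ (u₀ : ℝ³ → ℝ³) (u : ℝ → ℝ³ → ℝ³)
      (U : ℝ → 𝓢'(ℝ³, ℂ³)), FluidPDE.IsLerayHopfOn T ν 0 u₀ u →
      (∀ t ∈ Icc 0 T, IsDistributionOf (u t) (U t)) →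
      limsup (fun j : ℕ => ⨆ t ∈ Ioo 0 T, FunctionSpaces.lpBlockWeight (-1) ∞ (U t) (j : ℤ)) atTop <
        ENNReal.ofReal (c * ν) →
      ∃ (v : ℝ → ℝ³ → ℝ³) (p' : ℝ → ℝ³ → ℝ),
        FluidPDE.IsClassicalNSSolutionOn (Ioc 0 T) ν 0 v p' ∧ ∀ t ∈ Ioc 0 T, u t =ᵐ[volume] v t

/-- **Cheskidov–Shvydkoy's small-`B^{-1}_{∞,∞}` regularity criterion** (Arch. Ration. Mech.
Anal. 195 (2010), Cor. 3.3, p. 6 of arXiv:0708.3067: "Let `u(t)` be a Leray–Hopf solution of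
(NSE) on `[0,T]`. There is a constant `c > 0` such that if `‖u‖_{L^∞((0,T);B^{-1}_{∞,∞})} < cν`,
then `u(t)` is regular on `(0,T]`" — "this lemma [3.2] immediately yields the following
corollary"). Rendering: the smallness is imposed on `sup_{t ∈ (0,T)} ‖u(t)‖_{B^{-1}_{∞,∞}}`
(`⨆ t ∈ Ioo 0 T, eBesovNorm (-1) ∞ ∞ (U t)`), which dominates the printed `L^∞_t`
(essential) supremum, so this statement is implied by the printed one (for Leray–Hopf solutions
the two suprema agree by weak continuity, not used); inhomogeneous norm, constant and "regular"
as in `cheskidov_shvydkoy_inhom`. Derived from `cheskidov_shvydkoy_dyadic` in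
`cheskidov_shvydkoy_small_of_dyadic`. [cite: CheskidovShvydkoy2010, Cor. 3.3] -/
def cheskidov_shvydkoy_small : Prop :=
  ∃ c : ℝ, 0 < c ∧ ∀ (ν T : ℝ), 0 < ν → 0 < T → ∀ (u₀ : ℝ³ → ℝ³) (u : ℝ → ℝ³ → ℝ³)
      (U : ℝ → 𝓢'(ℝ³, ℂ³)), FluidPDE.IsLerayHopfOn T ν 0 u₀ u →
      (∀ t ∈ Icc 0 T, IsDistributionOf (u t) (U t)) →
      (⨆ t ∈ Ioo 0 T, FunctionSpaces.eBesovNorm (-1) ∞ ∞ (U t)) < ENNReal.ofReal (c * ν) →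
      ∃ (v : ℝ → ℝ³ → ℝ³) (p' : ℝ → ℝ³ → ℝ),
        FluidPDE.IsClassicalNSSolutionOn (Ioc 0 T) ν 0 v p' ∧ ∀ t ∈ Ioc 0 T, u t =ᵐ[volume] v t

/-- **Cor. 3.3 from Lemma 3.2** (Cheskidov–Shvydkoy 2010, p. 6: "this lemma immediately yields the
following corollary"), with the same constant: for `j ≥ 1`,
`sup_{t ∈ (0,T)} 2^{-j} ‖Δ̇_j U(t)‖_∞ ≤ sup_{t ∈ (0,T)} ‖U(t)‖_{B^{-1}_{∞,∞}}`
(`lpBlockWeight_succ_le_eBesovNorm`), so the `limsup_{j → ∞}` of Lemma 3.2 is at most the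
`L^∞_t B^{-1}_{∞,∞}` bound. [cite: CheskidovShvydkoy2010, Cor. 3.3] -/
theorem cheskidov_shvydkoy_small_of_dyadic (h : cheskidov_shvydkoy_dyadic) :
    cheskidov_shvydkoy_small := by
  obtain ⟨c, hc, H⟩ := h
  refine ⟨c, hc, fun ν T hν hT u₀ u U hLH hU hsmall => H ν T hν hT u₀ u U hLH hU ?_⟩
  refine lt_of_le_of_lt (limsup_le_of_le (by isBoundedDefault) ?_) hsmall
  filter_upwards [eventually_ge_atTop 1] with j hj
  obtain ⟨n, rfl⟩ : ∃ n : ℕ, j = n + 1 := ⟨j - 1, by omega⟩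
  refine iSup₂_mono fun t _ => ?_
  push_cast
  exact lpBlockWeight_succ_le_eBesovNorm (-1) ∞ (U t) n

/-- **The dyadic tails of a Leray–Hopf solution vanish at a.e. time** (on `ℝ³`): for a.e.
`t ∈ (0, T)`, `φ_{-1,∞}(U t) = limsup_j 2^{-j} ‖Δ̇_j U(t)‖_∞ = 0`. Indeed the weak gradient of a
Leray–Hopf solution has a jointly measurable version with finite dissipation
(`Fluid.IsLerayHopfOn.exists_measurable_weakGradient`), so `∫ |∇u(t)|² < ∞` for a.e. `t`;
by the Sobolev inequality `H¹(ℝ³) ⊂ L⁶(ℝ³)`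
(`Fluid.eLpNorm_six_le_lintegral_frobeniusNormSq_weakGradient`) `u(t) ∈ L⁶`, and `6 > 3 = d`
(`Literature.Analysis.FluidPDE.dyadicTail_eq_zero_of_eLpNormDistrib_ne_top`). This replaces the appeal to
"`u(t) ∈ C^∞(ℝ³)` on an interval of regularity, hence `φ(t) = 0`" in Cheskidov–Shvydkoy 2010,
proof of Thm. 3.1 (p. 6), by an a.e. statement valid for every Leray–Hopf solution. [folklore] -/
theorem ae_dyadicTail_eq_zero_of_isLerayHopfOn {ν T : ℝ} {u₀ : ℝ³ → ℝ³} {u : ℝ → ℝ³ → ℝ³}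
    {U : ℝ → 𝓢'(ℝ³, ℂ³)} (hu : FluidPDE.IsLerayHopfOn T ν 0 u₀ u)
    (hU : ∀ t ∈ Icc 0 T, IsDistributionOf (u t) (U t)) :
    ∀ᵐ t ∂(volume.restrict (Ioo 0 T)), dyadicTail (-1) ∞ (U t) = 0 := by
  obtain ⟨G, hGm, hG, hGint, -⟩ := hu.exists_measurable_weakGradient
  -- the dissipation density is measurable in time and finite at a.e. time
  have hmeas : Measurable fun s => ∫⁻ x, ENNReal.ofReal (FluidPDE.frobeniusNormSq (G s x)) := by
    have h : Measurable fun z : ℝ × ℝ³ => ENNReal.ofReal (FluidPDE.frobeniusNormSq (uncurry G z)) :=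
      ENNReal.measurable_ofReal.comp
        (LerayHopfProofs.continuous_frobeniusNormSq.comp_stronglyMeasurable hGm).measurable
    exact h.lintegral_prod_right'
  have hDfin : ∀ᵐ t ∂(volume.restrict (Ioo 0 T)),
      ∫⁻ x, ENNReal.ofReal (FluidPDE.frobeniusNormSq (G t x)) < ∞ := ae_lt_top hmeas hGint.ne
  haveI : Fact (1 ≤ (6 : ℝ≥0∞)) := ⟨by norm_num⟩
  filter_upwards [hG, hDfin, ae_restrict_mem measurableSet_Ioo] with t hGt hDt ht
  have ht' : t ∈ Icc 0 T := Ioo_subset_Icc_self ht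
  have hu2 : MemLp (u t) 2 volume := hu.memLp t ht'
  -- Sobolev: `u t ∈ L⁶`
  have h6 : MemLp (u t) 6 volume := by
    refine ⟨hu2.aestronglyMeasurable, ?_⟩
    refine (FluidPDE.eLpNorm_six_le_lintegral_frobeniusNormSq_weakGradient
      finrank_euclideanSpace_fin hGt hu2.eLpNorm_lt_top).trans_lt ?_
    exact ENNReal.mul_lt_top ENNReal.coe_lt_top
      (ENNReal.rpow_lt_top_of_nonneg (by norm_num) hDt.ne)
  -- `U t` is an `L⁶` distribution, and `6 > 3`
  have hU6 : FunctionSpaces.eLpNormDistrib 6 (U t) ≠ ∞ := by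
    rw [← (hU t ht').coe_toLp h6]
    exact ((FunctionSpaces.eLpNormDistrib_coe_le _).trans_lt enorm_lt_top).ne
  exact dyadicTail_eq_zero_of_eLpNormDistrib_ne_top (by
    rw [finrank_euclideanSpace_fin]; norm_num) hU6

/-- **From the jump hypothesis of Thm. 3.1 to the hypothesis of Lemma 3.2 on a left
neighbourhood** (Cheskidov–Shvydkoy 2010, proof of Thm. 3.1, p. 6, for Leray–Hopf solutions on
`ℝ³`): if the left jumps of the slice distributions at some `β ∈ (0, T]` satisfy
`limsup_{t₀ → β⁻} ‖U β - U t₀‖_{B^{-1}_{∞,∞}} < c`, then there is `t₁ ∈ [0, β)` with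
`limsup_{j → ∞} sup_{s ∈ (t₁, β)} 2^{-j} ‖Δ̇_j U(s)‖_∞ < 2c`: the dyadic tails vanish at a.e.
time (`ae_dyadicTail_eq_zero_of_isLerayHopfOn`), hence frequently as `t₀ → β⁻`
(`Literature.Analysis.FluidPDE.frequently_nhdsLT_of_ae_Ioo`), and the left-neighbourhood lemma
`Literature.Analysis.FluidPDE.exists_limsup_biSup_lpBlockWeight_lt` applies. What remains of the printed proof of
Thm. 3.1 is the application of Lemma 3.2 (`cheskidov_shvydkoy_dyadic`) to `u` restarted at a
time of `(t₁, β)` and Leray's continuation theorem (CS Thm. 2.4). [cite: CheskidovShvydkoy2010, proof of Thm. 3.1] -/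
theorem exists_limsup_biSup_lpBlockWeight_lt_of_isLerayHopfOn {ν T : ℝ} {u₀ : ℝ³ → ℝ³}
    {u : ℝ → ℝ³ → ℝ³} {U : ℝ → 𝓢'(ℝ³, ℂ³)} (hu : FluidPDE.IsLerayHopfOn T ν 0 u₀ u)
    (hU : ∀ t ∈ Icc 0 T, IsDistributionOf (u t) (U t)) {β : ℝ} (hβ : β ∈ Ioc 0 T) {c : ℝ≥0∞}
    (hjump : limsup (fun t₀ => FunctionSpaces.eBesovNorm (-1) ∞ ∞ (U β - U t₀)) (𝓝[<] β) < c) :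
    ∃ t₁ ∈ Ico 0 β, limsup (fun j : ℕ => ⨆ s ∈ Ioo t₁ β, FunctionSpaces.lpBlockWeight (-1) ∞ (U s) (j : ℤ))
      atTop < 2 * c := by
  have htail : ∃ᶠ t₀ in 𝓝[<] β, dyadicTail (-1) ∞ (U t₀) = 0 :=
    frequently_nhdsLT_of_ae_Ioo hβ (ae_dyadicTail_eq_zero_of_isLerayHopfOn hu hU)
  obtain ⟨t₁, ht₁β, h⟩ := exists_limsup_biSup_lpBlockWeight_lt hjump htail
  refine ⟨max t₁ 0, ⟨le_max_right _ _, max_lt ht₁β hβ.1⟩, lt_of_le_of_lt ?_ h⟩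
  refine limsup_le_limsup (Eventually.of_forall fun j => ?_)
  exact biSup_mono fun s hs => ⟨(le_max_left t₁ 0).trans_lt hs.1, hs.2⟩

/-- **Increments of a Leray–Hopf solution: inhomogeneous against homogeneous jumps.** For a
Leray–Hopf solution `u` on `[0, T)` with slice distributions `U t` (`t ∈ [0, T]`) and times
`t, t₀ ∈ [0, T]`, `‖U t - U t₀‖_{B^{-1}_{∞,∞}} ≤ 3 ‖U t - U t₀‖_{Ḃ^{-1}_{∞,∞}}`: the slices are
`L²` (`Fluid.IsLerayHopfOn.memLp`), so `U t - U t₀ ∈ L²` and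
`Literature.Analysis.FluidPDE.eBesovNorm_le_three_mul_eHomBesovNorm` applies with `q = 2 < ∞ = p`
(Cheskidov–Shvydkoy 2010, p. 7; design notes of `CriticalRegularity.lean`). [folklore] -/
theorem eBesovNorm_sub_le_of_isLerayHopfOn {ν T : ℝ} {u₀ : ℝ³ → ℝ³} {u : ℝ → ℝ³ → ℝ³}
    {U : ℝ → 𝓢'(ℝ³, ℂ³)} (hu : FluidPDE.IsLerayHopfOn T ν 0 u₀ u)
    (hU : ∀ t ∈ Icc 0 T, IsDistributionOf (u t) (U t)) {t t₀ : ℝ} (ht : t ∈ Icc 0 T)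
    (ht₀ : t₀ ∈ Icc 0 T) :
    FunctionSpaces.eBesovNorm (-1) ∞ ∞ (U t - U t₀) ≤ 3 * FunctionSpaces.eHomBesovNorm (-1) ∞ ∞ (U t - U t₀) :=
  eBesovNorm_le_three_mul_eHomBesovNorm (q := 2) (p := ∞) (by simp)
    ((hU t ht).eLpNormDistrib_sub_ne_top (hU t₀ ht₀) (hu.memLp t ht) (hu.memLp t₀ ht₀))

/-- **The accepted homogeneous rendering follows from the printed theorem**:
`cheskidov_shvydkoy_inhom → cheskidov_shvydkoy`. If the printed statement holds with constant
`c`, the homogeneous one holds with `c / 3`: for `t ∈ (0, T]` and `t₀ → t⁻` (eventually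
`t₀ ∈ (0, t) ⊆ [0, T]`) the increments satisfy
`‖U t - U t₀‖_{B^{-1}_{∞,∞}} ≤ 3 ‖U t - U t₀‖_{Ḃ^{-1}_{∞,∞}}`
(`eBesovNorm_sub_le_of_isLerayHopfOn`), hence
`sup_t limsup_{t₀ → t-} ‖·‖_{B^{-1}_{∞,∞}} ≤ 3 sup_t limsup_{t₀ → t-} ‖·‖_{Ḃ^{-1}_{∞,∞}} < 3 (c/3) ν = c ν`
(Cheskidov–Shvydkoy 2010, Thm. 3.1 with p. 7). [cite: CheskidovShvydkoy2010, Thm. 3.1] -/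
theorem cheskidov_shvydkoy_of_inhom (h : cheskidov_shvydkoy_inhom) : cheskidov_shvydkoy := by
  obtain ⟨c, hc, H⟩ := h
  refine ⟨c / 3, by positivity, fun ν T hν hT u₀ u U hLH hU hjump => H ν T hν hT u₀ u U hLH hU ?_⟩
  have key : ∀ t ∈ Ioc 0 T,
      limsup (fun t₀ => FunctionSpaces.eBesovNorm (-1) ∞ ∞ (U t - U t₀)) (𝓝[<] t) ≤
        3 * limsup (fun t₀ => FunctionSpaces.eHomBesovNorm (-1) ∞ ∞ (U t - U t₀)) (𝓝[<] t) := by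
    intro t ht
    rw [← ENNReal.limsup_const_mul_of_ne_top (by norm_num : (3 : ℝ≥0∞) ≠ ∞)]
    refine limsup_le_limsup ?_
    filter_upwards [Ioo_mem_nhdsLT ht.1] with t₀ ht₀
    exact eBesovNorm_sub_le_of_isLerayHopfOn hLH hU ⟨ht.1.le, ht.2⟩
      ⟨ht₀.1.le, (ht₀.2.le.trans ht.2)⟩
  calc ⨆ t ∈ Ioc 0 T, limsup (fun t₀ => FunctionSpaces.eBesovNorm (-1) ∞ ∞ (U t - U t₀)) (𝓝[<] t)
      ≤ ⨆ t ∈ Ioc 0 T, 3 * limsup (fun t₀ => FunctionSpaces.eHomBesovNorm (-1) ∞ ∞ (U t - U t₀)) (𝓝[<] t) :=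
        iSup₂_mono key
    _ = 3 * ⨆ t ∈ Ioc 0 T, limsup (fun t₀ => FunctionSpaces.eHomBesovNorm (-1) ∞ ∞ (U t - U t₀)) (𝓝[<] t) := by
        simp_rw [ENNReal.mul_iSup]
    _ < 3 * ENNReal.ofReal (c / 3 * ν) := by
        gcongr
        exact ENNReal.ofNat_ne_top
    _ = ENNReal.ofReal (c * ν) := by
        rw [← ENNReal.ofReal_ofNat 3, ← ENNReal.ofReal_mul (by norm_num)]
        congr 1
        ring

end Literature.Analysis.FluidPDE

end
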